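import Summits.QuantumFields.YangMills.Theorems.LuscherReductionTwistedTraceScalingStepKernelChart
import HarnessLib

/-!
# The EXACT action increment of a kinetic step and its VALLEY-GRADE quadratic expansion (no `σρ`, no `σ²` terms)
# (lane A of S-BASE, crux `TwistedTraceScaling` stmt-QuantumFields-20203; C3 VALLEY step sandwich — design note
# `pub/ym-fleet/ym-luscher-20007-p1/COARSE-DESIGN.md` §15)

Lane B's chart sandwich (`wilsonAction_step_ge/le`, `…StepKernelChart`) models the column action by `‖F(U) + D_U w‖²` and pays the errors
`η₁ ∋ 132√N·ρσ` and `η₂ ∋ σ²`; with `β η` in the exponent these are affordable on the Gaussian bulk `σ ≍ β^{−1}` (INNER) but NOT in the VALLEY, where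
`S(U) < 2η(β) = 2β^{−q}`, `q < 1/3`, and `βρσ ≍ β^{1/2−q} → ∞`.  Both terms are artefacts of the model `S ≈ ‖F‖²`: the increment of the action along a
kinetic step is EXACTLY affine-quadratic in the transported step.  With `X_p = X_p(W;U)` the transported step (`hol_p(W·U) = X_p · hol_p(U)`,
`…CovariantCurl`), `u₀`/`vecPart` the quaternion parts, `c_p = u₀(hol_p U)`, `F_p = vecPart(hol_p U)`, `x_p = vecPart X_p`:

* `plaqTerm_step_eq` — `S_p(W·U) − S_p(U) = 2(1 − u₀ X_p)·c_p + 2 x_p·F_p` (EXACT; `S_p = 2(1 − u₀ hol_p)`, tree normalisation);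
* `wilsonAction_step_eq` — summed over plaquettes;
* `two_mul_one_sub_scalarPart_eq` — `2(1 − u₀ A) = |vecPart A|² + (1 − u₀ A)²` (EXACT, unit quaternions);
* `transportStep_bounds` — for link steps in the upper hemisphere with components `≤ τ ≤ 1/30`: `|x_{p,c} − (D_U w)_{p,c}| ≤ 288τ²`, `|x_{p,c}| ≤ 24τ`,
  `0 ≤ 1 − u₀ X_p ≤ 837τ²` (`w = linkVec W`; lane B's `abs_vecPart_prod4_sub_sum_le` + `sum_vecPart_factors_eq_covCurl`);
* ★★ `abs_wilsonAction_step_sub_quadratic_le` — the VALLEY-GRADE expansion at any `U` with `S(U) ≤ σ < 2`: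
  `|S(W·U) − S(U) − 2 Σ_{p,c} (D_U w)_{p,c} F_{p,c} − Σ_p c_p Σ_c (D_U w)_{p,c}²| ≤ N_P·(1728 τ²√σ + 29376 τ³ + 700569 τ⁴)`;
  ★★ `wilsonAction_step_ge_valley` / `wilsonAction_step_le_valley` — the two-sided form with `(1 − σ/2)‖D_U w‖² ≤ Σ_p c_p|(D_Uw)_p|² ≤ ‖D_U w‖²`:
  `S(U) + 2⟪D_U w, F(U)⟫ + (1 − σ/2)‖D_U w‖² − E ≤ S(W·U) ≤ S(U) + 2⟪D_U w, F(U)⟫ + ‖D_U w‖² + E`, `E = N_P(1728τ²√σ + 29376τ³ + 700569τ⁴)`.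
With `τ ≍ ρ ≍ √(log β/β)` and ANY `σ → 0`: `βE → 0` — the precision the valley Schur test needs (gain `≍ β^{−p}` vs. errors `o(1)`), while the row-point
action `S(U)` stays EXACT (lane B: `S(U) ≥ ‖F(U)‖²`, the difference `Σ_p (1 − c_p)²` is a function of the row point only).
HONEST FRAMING: quaternion algebra on a fixed lattice; a brick for the stub lane of a child of the CONDITIONAL reduction route (femto rung R2b1);
not a gap, not Clay.
-/

set_option autoImplicit false

noncomputable section

open scoped Matrix BigOperators RealInnerProductSpace ComplexConjugate
open Literature.MathematicalPhysics.QuantumFieldTheory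
open Literature.MathematicalPhysics.QuantumLattice

namespace Summit.QuantumFields.YangMills.Theorems.FemtoTransferGap.TwoLattice.Cov

open Summit.QuantumFields.YangMills.Theorems.FemtoTransferGap
open Summit.QuantumFields.YangMills.Theorems.FemtoTransferGap.TwoLattice
open Summit.QuantumFields.YangMills.Theorems.FemtoTransferGap.TwoLattice.Stiff

variable {L : ℕ} [NeZero L]

/-! ## §1 The exact increment -/

omit [NeZero L] in
/-- ★ **EXACT plaquette increment**: `S_p(W·U) − S_p(U) = 2(1 − u₀ X_p)·u₀(hol_p U) + 2·vecPart(X_p)·vecPart(hol_p U)`, `X_p` the transported step.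
[cite: Luscher1983, §3] [cite: BrockerTomDieck1985, I (1.10)] -/
theorem plaqTerm_step_eq (W U : GaugeConfig 3 L SU2) (p : Plaquette 3 L) :
    2 * (1 - scalarPart (hol (W * U) p)) - 2 * (1 - scalarPart (hol U p)) =
      2 * (1 - scalarPart (transportStep W U p)) * scalarPart (hol U p) + 2 * (vecPart (transportStep W U p) ⬝ᵥ vecPart (hol U p)) := by
  rw [hol_mul_eq_transportStep_mul, one_sub_scalarPart_mul]
  ring

/-- ★ **EXACT action increment** along a kinetic step `V = W·U`. [cite: Luscher1983, §3] -/
theorem wilsonAction_step_eq (W U : GaugeConfig 3 L SU2) :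
    wilsonAction su2Rep (W * U) - wilsonAction su2Rep U =
      ∑ p : Plaquette 3 L, (2 * (1 - scalarPart (transportStep W U p)) * scalarPart (hol U p) +
        2 * (vecPart (transportStep W U p) ⬝ᵥ vecPart (hol U p))) := by
  rw [wilsonAction_eq_sum_scalarPart, wilsonAction_eq_sum_scalarPart, ← Finset.sum_sub_distrib]
  exact Finset.sum_congr rfl fun p _ => plaqTerm_step_eq W U p

/-- `2(1 − u₀ A) = |vecPart A|² + (1 − u₀ A)²` for a unit quaternion (EXACT). [cite: BrockerTomDieck1985, I (1.10)] -/
theorem two_mul_one_sub_scalarPart_eq (A : SU2) : 2 * (1 - scalarPart A) = ∑ c, vecPart A c ^ 2 + (1 - scalarPart A) ^ 2 := by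
  have h := scalarPart_sq_add A
  nlinarith [h]

/-! ## §2 The transported step of a small kinetic step -/

omit [NeZero L] in
/-- ★ **Transported-step bounds.**  If every link step is in the upper hemisphere with components `≤ τ ≤ 1/30`, then for every plaquette:
`|vecPart(X_p)_c − (D_U w)_{p,c}| ≤ 288τ²`, `|vecPart(X_p)_c| ≤ 24τ`, `0 ≤ u₀(X_p)` and `1 − u₀(X_p) ≤ 837τ²` (`w = linkVec W`).
[cite: Luscher1983, §3] [cite: BrockerTomDieck1985, I (1.10)] -/
theorem transportStep_bounds (W U : GaugeConfig 3 L SU2) {τ : ℝ} (hτ : τ ≤ 1 / 30)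
    (hs : ∀ e : Edge 3 L, 0 ≤ scalarPart (W e)) (hw : ∀ (e : Edge 3 L) (c : Fin 3), |vecPart (W e) c| ≤ τ) (p : Plaquette 3 L) :
    (∀ c, |vecPart (transportStep W U p) c - covCurl U (linkVec L W) (p, c)| ≤ 288 * τ ^ 2) ∧
      (∀ c, |vecPart (transportStep W U p) c| ≤ 24 * τ) ∧
      0 ≤ scalarPart (transportStep W U p) ∧ 1 - scalarPart (transportStep W U p) ≤ 837 * τ ^ 2 := by
  set A₁ := W (p.1, p.2.1.1) with hA₁
  set A₂ := ptrans1 U p * W (p.1.shift p.2.1.1, p.2.1.2) * (ptrans1 U p)⁻¹ with hA₂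
  set A₃ := (ptrans2 U p * W (p.1.shift p.2.1.2, p.2.1.1) * (ptrans2 U p)⁻¹)⁻¹ with hA₃
  set A₄ := (hol U p * W (p.1, p.2.1.2) * (hol U p)⁻¹)⁻¹ with hA₄
  have hX : transportStep W U p = A₁ * (A₂ * (A₃ * A₄)) := by
    simp only [transportStep, hA₁, hA₂, hA₃, hA₄, mul_assoc]
  have h1s : 0 ≤ scalarPart A₁ := hs _
  have h1v : ∀ b, |vecPart A₁ b| ≤ 3 * τ := fun b => (hw _ b).trans (by linarith [(abs_nonneg _).trans (hw (p.1, p.2.1.1) 0)])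
  obtain ⟨h2s, h2v⟩ := conj_factor_bounds (ptrans1 U p) (W (p.1.shift p.2.1.1, p.2.1.2)) (hs _) (hw _)
  obtain ⟨h3s, h3v⟩ := conj_inv_factor_bounds (ptrans2 U p) (W (p.1.shift p.2.1.2, p.2.1.1)) (hs _) (hw _)
  obtain ⟨h4s, h4v⟩ := conj_inv_factor_bounds (hol U p) (W (p.1, p.2.1.2)) (hs _) (hw _)
  have ht : 3 * τ ≤ 1 / 10 := by linarith
  obtain ⟨dX, bX, sX, aX⟩ := abs_vecPart_prod4_sub_sum_le h1s h2s h3s h4s ht h1v h2v h3v h4v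
  have hlin : ∀ c, vecPart A₁ c + vecPart A₂ c + vecPart A₃ c + vecPart A₄ c = covCurl U (linkVec L W) (p, c) := fun c => by
    rw [hA₁, hA₂, hA₃, hA₄]; exact sum_vecPart_factors_eq_covCurl W U p c
  rw [hX]
  refine ⟨fun c => ?_, fun c => (bX c).trans (by linarith), sX, by nlinarith [aX]⟩
  rw [← hlin c]
  nlinarith [dX c]

/-! ## §3 The valley-grade quadratic expansion -/

/-- The error of the expansion: `E(τ, σ) = N_P · (1728 τ²√σ + 29376 τ³ + 700569 τ⁴)` (`N_P` = number of plaquettes). [cite: Luscher1983, §3] -/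
def stepActionErr (τ σ : ℝ) : ℝ := (Fintype.card (Plaquette 3 L) : ℝ) * (1728 * τ ^ 2 * Real.sqrt σ + 29376 * τ ^ 3 + 700569 * τ ^ 4)

/-- `0 ≤ stepActionErr` for `τ ≥ 0`. [folklore] -/
theorem stepActionErr_nonneg {τ σ : ℝ} (hτ : 0 ≤ τ) : 0 ≤ stepActionErr (L := L) τ σ := by
  unfold stepActionErr; positivity

/-- ★★ **VALLEY-GRADE EXPANSION of the action along a kinetic step.**  For `S(U) ≤ σ < 2` and link steps in the upper hemisphere with components
`≤ τ ≤ 1/30` (`w = linkVec W`, `c_p = u₀(hol_p U)`, `F = plaqCurv U`):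
`|S(W·U) − S(U) − 2Σ_{p,c}(D_U w)_{p,c}F_{p,c} − Σ_p c_p Σ_c (D_U w)_{p,c}²| ≤ N_P(1728τ²√σ + 29376τ³ + 700569τ⁴)`.  No `σρ` and no `σ²` term.
[cite: Luscher1983, §3] -/
theorem abs_wilsonAction_step_sub_quadratic_le (W U : GaugeConfig 3 L SU2) {τ σ : ℝ} (hτ : τ ≤ 1 / 30) (hσ : σ < 2)
    (hS : wilsonAction su2Rep U ≤ σ) (hs : ∀ e : Edge 3 L, 0 ≤ scalarPart (W e)) (hw : ∀ (e : Edge 3 L) (c : Fin 3), |vecPart (W e) c| ≤ τ) :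
    |wilsonAction su2Rep (W * U) - wilsonAction su2Rep U
        - 2 * ∑ p : Plaquette 3 L, ∑ c, covCurl U (linkVec L W) (p, c) * plaqCurv U (p, c)
        - ∑ p : Plaquette 3 L, scalarPart (hol U p) * ∑ c, covCurl U (linkVec L W) (p, c) ^ 2| ≤ stepActionErr (L := L) τ σ := by
  have hτ0 : 0 ≤ τ := (abs_nonneg _).trans (hw ((0 : Site 3 L), 0) 0)
  set D := covCurl U (linkVec L W) with hD
  -- per-plaquette estimate
  have key : ∀ p : Plaquette 3 L,
      |(2 * (1 - scalarPart (transportStep W U p)) * scalarPart (hol U p) + 2 * (vecPart (transportStep W U p) ⬝ᵥ vecPart (hol U p)))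
        - 2 * ∑ c, D (p, c) * plaqCurv U (p, c) - scalarPart (hol U p) * ∑ c, D (p, c) ^ 2|
        ≤ 1728 * τ ^ 2 * Real.sqrt σ + 29376 * τ ^ 3 + 700569 * τ ^ 4 := by
    intro p
    obtain ⟨dX, bX, sX, aX⟩ := transportStep_bounds W U hτ hs hw p
    obtain ⟨hH, hF⟩ := hol_hypotheses_of_wilsonAction_le U hσ hS p
    set X := transportStep W U p with hXdef
    set cp := scalarPart (hol U p) with hcp
    have hcp1 : cp ≤ 1 := by
      have h := scalarPart_sq_add (hol U p)
      have h2 : 0 ≤ ∑ a, vecPart (hol U p) a ^ 2 := Finset.sum_nonneg fun a _ => sq_nonneg _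
      nlinarith
    have hDb : ∀ c, |D (p, c)| ≤ 10 * τ := fun c => abs_covCurl_apply_le U (w := linkVec L W) (fun e b => by rw [linkVec_apply]; exact hw e b) (p, c)
    -- (a) the quadratic identity for the step
    have hquad : 2 * (1 - scalarPart X) = ∑ c, vecPart X c ^ 2 + (1 - scalarPart X) ^ 2 := two_mul_one_sub_scalarPart_eq X
    -- (b) `|x|² − |Dw|²`
    have hsq : |∑ c, vecPart X c ^ 2 - ∑ c, D (p, c) ^ 2| ≤ 29376 * τ ^ 3 := by
      rw [← Finset.sum_sub_distrib]
      have hc : ∀ c, |vecPart X c ^ 2 - D (p, c) ^ 2| ≤ 288 * τ ^ 2 * (34 * τ) := fun c => by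
        have e : vecPart X c ^ 2 - D (p, c) ^ 2 = (vecPart X c - D (p, c)) * (vecPart X c + D (p, c)) := by ring
        rw [e, abs_mul]
        refine mul_le_mul (dX c) ((abs_add_le _ _).trans (by linarith [bX c, hDb c])) (abs_nonneg _) (by positivity)
      calc |∑ c, (vecPart X c ^ 2 - D (p, c) ^ 2)| ≤ ∑ c, |vecPart X c ^ 2 - D (p, c) ^ 2| := Finset.abs_sum_le_sum_abs _ _
        _ ≤ ∑ _c : Fin 3, 288 * τ ^ 2 * (34 * τ) := Finset.sum_le_sum fun c _ => hc c
        _ = 29376 * τ ^ 3 := by simp; ring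
    -- (c) the linear cross term
    have hlin : |vecPart X ⬝ᵥ vecPart (hol U p) - ∑ c, D (p, c) * plaqCurv U (p, c)| ≤ 3 * (288 * τ ^ 2) * Real.sqrt σ := by
      have e : vecPart X ⬝ᵥ vecPart (hol U p) - ∑ c, D (p, c) * plaqCurv U (p, c) = (fun c => vecPart X c - D (p, c)) ⬝ᵥ vecPart (hol U p) := by
        simp only [dotProduct, plaqCurv_apply, ← Finset.sum_sub_distrib]
        exact Finset.sum_congr rfl fun c _ => by ring
      rw [e]
      exact abs_dot_le dX hF
    -- (d) assemble
    have hsplit : (2 * (1 - scalarPart X) * cp + 2 * (vecPart X ⬝ᵥ vecPart (hol U p))) - 2 * ∑ c, D (p, c) * plaqCurv U (p, c) - cp * ∑ c, D (p, c) ^ 2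
        = cp * (∑ c, vecPart X c ^ 2 - ∑ c, D (p, c) ^ 2) + cp * (1 - scalarPart X) ^ 2
          + 2 * (vecPart X ⬝ᵥ vecPart (hol U p) - ∑ c, D (p, c) * plaqCurv U (p, c)) := by
      rw [hquad]; ring
    rw [hsplit]
    have t1 : |cp * (∑ c, vecPart X c ^ 2 - ∑ c, D (p, c) ^ 2)| ≤ 29376 * τ ^ 3 := by
      rw [abs_mul, abs_of_nonneg hH]
      calc cp * |∑ c, vecPart X c ^ 2 - ∑ c, D (p, c) ^ 2| ≤ 1 * (29376 * τ ^ 3) := mul_le_mul hcp1 hsq (abs_nonneg _) zero_le_one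
        _ = 29376 * τ ^ 3 := one_mul _
    have t2 : |cp * (1 - scalarPart X) ^ 2| ≤ 700569 * τ ^ 4 := by
      rw [abs_mul, abs_of_nonneg hH, abs_of_nonneg (sq_nonneg _)]
      have h0 : 0 ≤ 1 - scalarPart X := by
        have h := scalarPart_sq_add X
        have h2 : 0 ≤ ∑ a, vecPart X a ^ 2 := Finset.sum_nonneg fun a _ => sq_nonneg _
        nlinarith
      calc cp * (1 - scalarPart X) ^ 2 ≤ 1 * (837 * τ ^ 2) ^ 2 :=
            mul_le_mul hcp1 (pow_le_pow_left₀ h0 aX 2) (sq_nonneg _) zero_le_one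
        _ = 700569 * τ ^ 4 := by ring
    have t3 : |2 * (vecPart X ⬝ᵥ vecPart (hol U p) - ∑ c, D (p, c) * plaqCurv U (p, c))| ≤ 1728 * τ ^ 2 * Real.sqrt σ := by
      rw [abs_mul, abs_two]; linarith [hlin]
    have := abs_add_le (cp * (∑ c, vecPart X c ^ 2 - ∑ c, D (p, c) ^ 2) + cp * (1 - scalarPart X) ^ 2)
      (2 * (vecPart X ⬝ᵥ vecPart (hol U p) - ∑ c, D (p, c) * plaqCurv U (p, c)))
    have := abs_add_le (cp * (∑ c, vecPart X c ^ 2 - ∑ c, D (p, c) ^ 2)) (cp * (1 - scalarPart X) ^ 2)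
    linarith
  -- sum over plaquettes
  rw [wilsonAction_step_eq, Finset.mul_sum, ← Finset.sum_sub_distrib, ← Finset.sum_sub_distrib]
  refine (Finset.abs_sum_le_sum_abs _ _).trans ?_
  calc ∑ p : Plaquette 3 L, |2 * (1 - scalarPart (transportStep W U p)) * scalarPart (hol U p) +
          2 * (vecPart (transportStep W U p) ⬝ᵥ vecPart (hol U p)) - 2 * ∑ c, D (p, c) * plaqCurv U (p, c) -
          scalarPart (hol U p) * ∑ c, D (p, c) ^ 2|
      ≤ ∑ _p : Plaquette 3 L, (1728 * τ ^ 2 * Real.sqrt σ + 29376 * τ ^ 3 + 700569 * τ ^ 4) := Finset.sum_le_sum fun p _ => key p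
    _ = stepActionErr (L := L) τ σ := by rw [Finset.sum_const, Finset.card_univ, nsmul_eq_mul]; rfl

/-! ## §4 Euclidean packaging: the two-sided valley sandwich -/

/-- `Σ_{p,c} (D_U w)_{p,c} F_{p,c} = ⟪D_U w, F(U)⟫`. [folklore] -/
theorem sum_covCurl_mul_plaqCurv_eq_inner (U : GaugeConfig 3 L SU2) (v : LinkSpace L) :
    ∑ p : Plaquette 3 L, ∑ c, covCurl U v (p, c) * plaqCurv U (p, c) = ⟪covCurl U v, plaqCurv U⟫ := by
  rw [PiLp.inner_apply, Fintype.sum_prod_type (f := fun x : Plaquette 3 L × Fin 3 => ⟪covCurl U v x, plaqCurv U x⟫)]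
  refine Finset.sum_congr rfl fun p _ => Finset.sum_congr rfl fun c _ => ?_
  rw [RCLike.inner_apply, conj_trivial, mul_comm]

/-- `Σ_{p,c} (D_U w)_{p,c}² = ‖D_U w‖²`. [folklore] -/
theorem sum_covCurl_sq_eq_norm_sq (U : GaugeConfig 3 L SU2) (v : LinkSpace L) :
    ∑ p : Plaquette 3 L, ∑ c, covCurl U v (p, c) ^ 2 = ‖covCurl U v‖ ^ 2 := by
  rw [EuclideanSpace.norm_sq_eq, Fintype.sum_prod_type (f := fun x : Plaquette 3 L × Fin 3 => ‖covCurl U v x‖ ^ 2)]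
  refine Finset.sum_congr rfl fun p _ => Finset.sum_congr rfl fun c _ => ?_
  rw [Real.norm_eq_abs, sq_abs]

/-- On `{S ≤ σ}` every plaquette scalar part is `≥ 1 − σ/2`: `c_p = 1 − S_p/2 ≥ 1 − σ/2`. [folklore] -/
theorem one_sub_half_le_scalarPart_hol (U : GaugeConfig 3 L SU2) {σ : ℝ} (hS : wilsonAction su2Rep U ≤ σ) (p : Plaquette 3 L) :
    1 - σ / 2 ≤ scalarPart (hol U p) := by
  rw [wilsonAction_eq_sum_scalarPart] at hS
  have hle : 2 * (1 - scalarPart (hol U p)) ≤ ∑ q : Plaquette 3 L, 2 * (1 - scalarPart (hol U q)) :=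
    Finset.single_le_sum (f := fun q => 2 * (1 - scalarPart (hol U q))) (fun q _ => by
      have h := scalarPart_sq_add (hol U q)
      have h2 : 0 ≤ ∑ a, vecPart (hol U q) a ^ 2 := Finset.sum_nonneg fun a _ => sq_nonneg _
      nlinarith) (Finset.mem_univ p)
  linarith

/-- The weighted stiffness is two-sided by the plain one: `(1 − σ/2)‖D_U v‖² ≤ Σ_p c_p |(D_U v)_p|² ≤ ‖D_U v‖²` on `{S ≤ σ}`, `σ < 2`. [folklore] -/
theorem weighted_stiffness_bounds (U : GaugeConfig 3 L SU2) {σ : ℝ} (hS : wilsonAction su2Rep U ≤ σ) (v : LinkSpace L) :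
    (1 - σ / 2) * ‖covCurl U v‖ ^ 2 ≤ ∑ p : Plaquette 3 L, scalarPart (hol U p) * ∑ c, covCurl U v (p, c) ^ 2 ∧
      ∑ p : Plaquette 3 L, scalarPart (hol U p) * ∑ c, covCurl U v (p, c) ^ 2 ≤ ‖covCurl U v‖ ^ 2 := by
  rw [← sum_covCurl_sq_eq_norm_sq, Finset.mul_sum]
  refine ⟨Finset.sum_le_sum fun p _ => ?_, Finset.sum_le_sum fun p _ => ?_⟩
  · exact mul_le_mul_of_nonneg_right (one_sub_half_le_scalarPart_hol U hS p) (Finset.sum_nonneg fun c _ => sq_nonneg _)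
  · have hcp1 : scalarPart (hol U p) ≤ 1 := by
      have h := scalarPart_sq_add (hol U p)
      have h2 : 0 ≤ ∑ a, vecPart (hol U p) a ^ 2 := Finset.sum_nonneg fun a _ => sq_nonneg _
      nlinarith
    calc scalarPart (hol U p) * ∑ c, covCurl U v (p, c) ^ 2 ≤ 1 * ∑ c, covCurl U v (p, c) ^ 2 :=
          mul_le_mul_of_nonneg_right hcp1 (Finset.sum_nonneg fun c _ => sq_nonneg _)
      _ = ∑ c, covCurl U v (p, c) ^ 2 := one_mul _

/-- ★★ **VALLEY-GRADE LOWER BOUND on the column action**: `S(U) + 2⟪D_U w, F(U)⟫ + (1 − σ/2)‖D_U w‖² − E ≤ S(W·U)`.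
[cite: Luscher1983, §3] -/
theorem wilsonAction_step_ge_valley (W U : GaugeConfig 3 L SU2) {τ σ : ℝ} (hτ : τ ≤ 1 / 30) (hσ : σ < 2)
    (hS : wilsonAction su2Rep U ≤ σ) (hs : ∀ e : Edge 3 L, 0 ≤ scalarPart (W e)) (hw : ∀ (e : Edge 3 L) (c : Fin 3), |vecPart (W e) c| ≤ τ) :
    wilsonAction su2Rep U + 2 * ⟪covCurl U (linkVec L W), plaqCurv U⟫ + (1 - σ / 2) * ‖covCurl U (linkVec L W)‖ ^ 2 - stepActionErr (L := L) τ σ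
      ≤ wilsonAction su2Rep (W * U) := by
  have h := abs_wilsonAction_step_sub_quadratic_le W U hτ hσ hS hs hw
  rw [sum_covCurl_mul_plaqCurv_eq_inner] at h
  have hw' := (weighted_stiffness_bounds U hS (linkVec L W)).1
  have := (abs_le.mp h).1
  linarith

/-- ★★ **VALLEY-GRADE UPPER BOUND on the column action**: `S(W·U) ≤ S(U) + 2⟪D_U w, F(U)⟫ + ‖D_U w‖² + E`. [cite: Luscher1983, §3] -/
theorem wilsonAction_step_le_valley (W U : GaugeConfig 3 L SU2) {τ σ : ℝ} (hτ : τ ≤ 1 / 30) (hσ : σ < 2)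
    (hS : wilsonAction su2Rep U ≤ σ) (hs : ∀ e : Edge 3 L, 0 ≤ scalarPart (W e)) (hw : ∀ (e : Edge 3 L) (c : Fin 3), |vecPart (W e) c| ≤ τ) :
    wilsonAction su2Rep (W * U) ≤
      wilsonAction su2Rep U + 2 * ⟪covCurl U (linkVec L W), plaqCurv U⟫ + ‖covCurl U (linkVec L W)‖ ^ 2 + stepActionErr (L := L) τ σ := by
  have h := abs_wilsonAction_step_sub_quadratic_le W U hτ hσ hS hs hw
  rw [sum_covCurl_mul_plaqCurv_eq_inner] at h
  have hw' := (weighted_stiffness_bounds U hS (linkVec L W)).2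
  have := (abs_le.mp h).2
  linarith

/-- ★ **Completed square**: `S(U) + 2⟪D w, F⟫ + ‖D w‖² = ‖F + D w‖² + (S(U) − ‖F‖²)`, and `S(U) − ‖F(U)‖² ≥ 0` (`norm_plaqCurv_sq_le_wilsonAction`): the
valley model is lane B's model `‖F(U) + D_U w‖²` shifted by a non-negative function of the ROW point. [folklore] -/
theorem valleyModel_eq_completed_square (U : GaugeConfig 3 L SU2) (v : LinkSpace L) :
    wilsonAction su2Rep U + 2 * ⟪covCurl U v, plaqCurv U⟫ + ‖covCurl U v‖ ^ 2 =
      ‖plaqCurv U + covCurl U v‖ ^ 2 + (wilsonAction su2Rep U - ‖plaqCurv U‖ ^ 2) := by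
  rw [norm_add_sq_real, real_inner_comm]
  ring

end Summit.QuantumFields.YangMills.Theorems.FemtoTransferGap.TwoLattice.Cov

end
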